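import Summits.BirchSwinnertonDyer.BirchSwinnertonDyer.Theorems.AlignedTransportAtTwoMainConjectureOfRankZeroBSDAtTwoHalfDescentLayerIndexGrowthFiniteTwistHonest
import Literature.NumberTheory.EllipticCurves.FineSelmerCoefficientMapProofs
import HarnessLib

/-!
# Route `AlignedTransportAtTwo`, crux C2 `MainConjectureOfRankZeroBSDAtTwo` (stmt-BirchSwinnertonDyer-22298):
# ABOVE THE FIRST LAYER THE TWIST AND THE CURVE COINCIDE — for `K_1 = K(√d)` the first layer of a `ℤ_p`-extension and EVERY `m ≥ 1`:
# `#Sel_{p^∞}(W^{(d)}/K_m) = #Sel_{p^∞}(W/K_m)`, `#A_m(W^{(d)}) = #A_m(W)` and `#ker g_m(W^{(d)}) = #ker g_m(W)` — Greenberg's control kernels of the twist and of the curve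
# are the same from the first layer on; ALL the difference between `E` and `E^{(d)}` along the tower sits at level `0` (`#Sel_{p^∞}(·/K)`, `#ker g_0(·)`)

HONEST FRAMING (cell `bsd-f1-sign2`, WIDTH-5 attached prover seat `bsd-line-att-p5` gen 59 on line `birth` of the lead `bsd-line-att-p2`;
`--supports` stmt-BirchSwinnertonDyer-22298, closes nothing; BSD is NOT proved by any of this; the crux C2, its verdict «blocked-on
`Rank1Residual.GreenbergMuConjectureIrreducible`» and every registered stub (P / T / Kμ / LimDoor / MuIneqʳ / PFμ⁺) are untouched). THEOREMS ONLY — no `def`,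
no instance, no named fact, no `sorry`. Sequel of this gen's `…GrowthFiniteTwistRelaxed` (`#A_n = #ker g_n · #Sel_n`, `[A_n : Sel_n] = #ker g_n`) and `…GrowthFiniteTwistHonest`
(whose honest door carries the factors `#ker g_n(W′)` and `#ker g_{n+1}(W)`): this file says what `ker g_m` of the TWIST is for `m ≥ 1`.

THE POINT. (§1, any `p`, abstract) A pair of coefficient isomorphisms `Ψ_m : H¹(K_m, W′[p^∞]) ≃ H¹(K_m, W[p^∞])`, `Ψ_∞ : H¹(K_∞, W′[p^∞]) ≃ H¹(K_∞, W[p^∞])` matching the Selmer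
groups at `K_m` and at `K_∞` and COMPATIBLE WITH RESTRICTION (`h_m ∘ Ψ_m = Ψ_∞ ∘ h′_m`) carries Greenberg's preimage `A_m(W′) = h′_m⁻¹(Sel′_∞)` onto `A_m(W)`
(`map_twist_selmerInftyPreimage_eq`), hence ★★★ **`#ker g_m(W′) = [A′_m : Sel′_m] = [A_m : Sel_m] = #ker g_m(W)`** (`natCard_kerG_eq_natCard_twist_kerG`, Mathlib `relIndex_map_map_of_injective`).
(§2) For the quadratic twist `W′ = W^{(d)}` the tree's `Ψ_θ = twistH1Equiv` (Greenberg «`A_s = A` as `G_{F_∞}`-modules») exists over EVERY subgroup fixing `θ = √d` — every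
`Gal(K̄/K_m)`, `m ≥ 1`, and `Gal(K̄/K_∞)` once `Gal(K̄/K_1)` fixes `θ` — and these `Ψ_θ` COMMUTE WITH RESTRICTION (`twistH1Equiv_resOfLe`: both are maps of `H¹` along the same
compatible pair, tree `resOfLe_comp_resH1Hom_id`). Hence for every `m ≥ 1`: ★★★ **`#Sel_{p^∞}(W^{(d)}/K_m) = #Sel_{p^∞}(W/K_m)`**, **`#A_m(W^{(d)}) = #A_m(W)`**,
**`#ker g_m(W^{(d)}) = #ker g_m(W)`** (`natCard_kerG_quadraticTwist_eq`); over `ℚ` with `κ` cyclotomic and `d = 2`: **`#ker g_m(E^{(2)}) = #ker g_m(E)` for all `m ≥ 1`**. READING for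
this gen's honest door / `μ`-bound `2^{μ₂} ∣ #Sel_{2^∞}(E^{(2)}/ℚ)·#ker g_0(E^{(2)})·#ker g_1(E)`: the last factor is ALSO `#ker g_1(E^{(2)})`, and by `…Relaxed` `#ker g_0(E^{(2)}) =
[Sel♯_0(E^{(2)}) : Sel(E^{(2)}/ℚ)] · [A_0(E^{(2)}) : Sel♯_0(E^{(2)})]` with the second factor dividing `#ker g_1(E)`: along the whole tower the twist contributes exactly ONE new number
beyond the curve's own control data — the index `[Sel♯_0(E^{(2)}) : Sel_{2^∞}(E^{(2)}/ℚ)]`, supported at `2` and the bad places (`…RelaxedPlaces`), bounded by local numbers (`…RelaxedIndex`).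
What is NOT claimed: `μ(X(W^{(d)}/K_∞)) = μ(X(W/K_∞))` (true — the `Λ`-modules differ by the character twist `T ↦ (1+T)χ(γ)−1` — but not typed here); nothing numerical; C2 untouched.
Memo `Cruxes/MainConjectureOfRankZeroBSDAtTwo/RELAXED-PREIMAGE-att-p5-g59.md`.

References: R. Greenberg, LNM 1716 (1999), §3 pp. 85–90, §4 p. 107 («`Sel_E(F_∞)_p` for `A_s`») [GreenbergLNM1716]; K. Rubin, *Euler Systems*, Ch. VI §1–§2 [Rubin2000];
J.-P. Serre, *Galois Cohomology*, I.§2.4–2.5, I.§5.3 [SerreGaloisCohomology1997]; J. Silverman, AEC X.2 Prop. 2.4, X.§4 [SilvermanAEC2009]; L. Washington, GTM 83 §13.1 [Washington1997].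
-/

set_option linter.dupNamespace false
set_option autoImplicit false

noncomputable section

open scoped Classical

universe u

namespace Summit.BirchSwinnertonDyer.BirchSwinnertonDyer.Theorems.AlignedTransportAtTwoHalfDescentLayerIndexGrowthFiniteTwistKernel

open WeierstrassCurve Literature.NumberTheory.EllipticCurves Literature.NumberTheory.EllipticCurves.QuadraticTwistSelmer
  Literature.NumberTheory.EllipticCurves.FineSelmerCoefficientMap
  Summit.BirchSwinnertonDyer.BirchSwinnertonDyer.Theorems
  Summit.BirchSwinnertonDyer.BirchSwinnertonDyer.Theorems.AlignedTransportAtTwoHalfDescentLayerIndexGrowthFiniteTwistRelaxed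

/-! ## §1 Abstract: a restriction-compatible pair of twisting isomorphisms identifies Greenberg's preimages and control kernels -/

section Abstract

variable {K : Type u} [Field K] [NumberField K] (W W' : WeierstrassCurve K) {p : ℕ} [hp : Fact p.Prime] (κ : ZpExtension K p) (m : ℕ)
  (Ψ : W'.subgroupH1 p (κ.layerSubgroup m) ≃+ W.subgroupH1 p (κ.layerSubgroup m))
  (Ψi : W'.subgroupH1 p κ.kerSubgroup ≃+ W.subgroupH1 p κ.kerSubgroup)

/-- **`x ∈ A_m(W′) ⟺ Ψ_m x ∈ A_m(W)`** for a pair `(Ψ_m, Ψ_∞)` matching `Sel_∞` and compatible with restriction (`h_m ∘ Ψ_m = Ψ_∞ ∘ h′_m`). [cite: GreenbergLNM1716, §3 p. 85, §4 p. 107] -/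
theorem mem_selmerInftyPreimage_iff_twist (hΨisel : ∀ x, x ∈ W'.selmerInfty κ ↔ Ψi x ∈ W.selmerInfty κ)
    (hcomm : ∀ x, W.layerToInfty κ m (Ψ x) = Ψi (W'.layerToInfty κ m x)) (x : W'.subgroupH1 p (κ.layerSubgroup m)) :
    x ∈ W'.selmerInftyPreimage κ m ↔ Ψ x ∈ W.selmerInftyPreimage κ m := by
  rw [mem_selmerInftyPreimage_iff, mem_selmerInftyPreimage_iff, hcomm, hΨisel]

/-- **`Ψ_m(A_m(W′)) = A_m(W)`**. [cite: GreenbergLNM1716, §3 p. 85, §4 p. 107] -/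
theorem map_twist_selmerInftyPreimage_eq (hΨisel : ∀ x, x ∈ W'.selmerInfty κ ↔ Ψi x ∈ W.selmerInfty κ)
    (hcomm : ∀ x, W.layerToInfty κ m (Ψ x) = Ψi (W'.layerToInfty κ m x)) :
    (W'.selmerInftyPreimage κ m).map Ψ.toAddMonoidHom = W.selmerInftyPreimage κ m := by
  ext y
  constructor
  · rintro ⟨x, hx, rfl⟩
    exact (mem_selmerInftyPreimage_iff_twist W W' κ m Ψ Ψi hΨisel hcomm x).mp hx
  · intro hy
    refine ⟨Ψ.symm y, (mem_selmerInftyPreimage_iff_twist W W' κ m Ψ Ψi hΨisel hcomm _).mpr (by rw [AddEquiv.apply_symm_apply]; exact hy), ?_⟩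
    rw [AddEquiv.coe_toAddMonoidHom, AddEquiv.apply_symm_apply]

/-- **`Ψ_m(Sel_{p^∞}(W′/K_m)) = Sel_{p^∞}(W/K_m)`** (any `p`, any layer). [cite: GreenbergLNM1716, §4 p. 107] -/
theorem map_twist_selmerLayer_eq (hΨsel : ∀ x, x ∈ W'.selmerLayer κ m ↔ Ψ x ∈ W.selmerLayer κ m) :
    (W'.selmerLayer κ m).map Ψ.toAddMonoidHom = W.selmerLayer κ m := by
  ext y
  constructor
  · rintro ⟨x, hx, rfl⟩
    exact (hΨsel x).mp hx
  · intro hy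
    refine ⟨Ψ.symm y, (hΨsel _).mpr (by rw [AddEquiv.apply_symm_apply]; exact hy), ?_⟩
    rw [AddEquiv.coe_toAddMonoidHom, AddEquiv.apply_symm_apply]

/-- `#Sel_{p^∞}(W/K_m) = #Sel_{p^∞}(W′/K_m)`. [cite: GreenbergLNM1716, §4 p. 107] -/
theorem natCard_selmerLayer_eq_natCard_twist (hΨsel : ∀ x, x ∈ W'.selmerLayer κ m ↔ Ψ x ∈ W.selmerLayer κ m) :
    Nat.card (W.selmerLayer κ m) = Nat.card (W'.selmerLayer κ m) := by
  rw [← map_twist_selmerLayer_eq W W' κ m Ψ hΨsel]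
  exact AddSubgroup.card_map_of_injective Ψ.injective

/-- `#A_m(W) = #A_m(W′)`. [cite: GreenbergLNM1716, §3 p. 85, §4 p. 107] -/
theorem natCard_selmerInftyPreimage_eq_natCard_twist (hΨisel : ∀ x, x ∈ W'.selmerInfty κ ↔ Ψi x ∈ W.selmerInfty κ)
    (hcomm : ∀ x, W.layerToInfty κ m (Ψ x) = Ψi (W'.layerToInfty κ m x)) :
    Nat.card (W.selmerInftyPreimage κ m) = Nat.card (W'.selmerInftyPreimage κ m) := by
  rw [← map_twist_selmerInftyPreimage_eq W W' κ m Ψ Ψi hΨisel hcomm]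
  exact AddSubgroup.card_map_of_injective Ψ.injective

/-- ★★★ **`#ker g_m(W) = #ker g_m(W′)`**: Greenberg's control kernels `ker g_m = A_m/Sel_m` of two curves whose `H¹`'s are identified at `K_m` and at `K_∞` compatibly with restriction and
with the Selmer conditions COINCIDE (`[A : Sel]` is invariant under the isomorphism `Ψ_m`; `Nat.card`, no finiteness). [cite: GreenbergLNM1716, §3 pp. 85–90, §4 p. 107] -/
theorem natCard_kerG_eq_natCard_twist_kerG (hΨsel : ∀ x, x ∈ W'.selmerLayer κ m ↔ Ψ x ∈ W.selmerLayer κ m)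
    (hΨisel : ∀ x, x ∈ W'.selmerInfty κ ↔ Ψi x ∈ W.selmerInfty κ) (hcomm : ∀ x, W.layerToInfty κ m (Ψ x) = Ψi (W'.layerToInfty κ m x)) :
    Nat.card (W.KerG κ m) = Nat.card (W'.KerG κ m) := by
  rw [← relIndex_selmerLayer_selmerInftyPreimage W κ m, ← relIndex_selmerLayer_selmerInftyPreimage W' κ m,
    ← map_twist_selmerLayer_eq W W' κ m Ψ hΨsel, ← map_twist_selmerInftyPreimage_eq W W' κ m Ψ Ψi hΨisel hcomm]
  exact AddSubgroup.relIndex_map_map_of_injective _ _ Ψ.injective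

end Abstract

/-! ## §2 The quadratic twist: `Ψ_θ` commutes with restriction; `#Sel_m`, `#A_m`, `#ker g_m` agree for `W` and `W^{(d)}` at every `m ≥ 1` -/

section Quadratic

variable {K : Type u} [Field K] [NumberField K] (W : WeierstrassCurve K) {C : VariableChange K} (hC : C • W = W.quadraticTwist 1)
  {d : K} (hd : d ≠ 0) {θ : AlgebraicClosure K} (hθ : θ ^ 2 = algebraMap K (AlgebraicClosure K) d) (p : ℕ)

/-- ★ **`Ψ_θ` COMMUTES WITH RESTRICTION**: for subgroups `H ≤ H′` of `Γ_K` both fixing `θ`, `res_{H′→H} ∘ Ψ_θ^{H′} = Ψ_θ^{H} ∘ res′_{H′→H}` on `H¹(H′, W^{(d)}[p^∞])` — both composites are the map of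
`H¹` along the compatible pair `(H ↪ H′, e_θ)` (tree `resOfLe_comp_resH1Hom_id`). [cite: SerreGaloisCohomology1997, I.§2.4–2.5] [cite: GreenbergLNM1716, §4 p. 107] -/
theorem twistH1Equiv_resOfLe {H H' : Subgroup (Field.absoluteGaloisGroup K)} [H.Normal] [H'.Normal] (hle : H ≤ H')
    (hH : ∀ σ : Field.absoluteGaloisGroup K, σ ∈ H → σ • θ = θ) (hH' : ∀ σ : Field.absoluteGaloisGroup K, σ ∈ H' → σ • θ = θ)
    (x : (W.quadraticTwist d).subgroupH1 p H') :
    W.resOfLe p hle (twistH1Equiv W hC hd hθ p H' hH' x) = twistH1Equiv W hC hd hθ p H hH ((W.quadraticTwist d).resOfLe p hle x) := by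
  simp only [twistH1Equiv, CoeffTwist.coeffH1Equiv_eq_subgroupH1Congr, subgroupH1Congr_apply]
  exact DFunLike.congr_fun (resOfLe_comp_resH1Hom_id (M := (W.quadraticTwist d).geomPrimaryTorsion p) (M' := W.geomPrimaryTorsion p) hle _ _ _) x

variable {p} [hp : Fact p.Prime] (κ : ZpExtension K p)

omit [NumberField K] in
/-- `Gal(K̄/K_m)` fixes `θ` for `m ≥ 1` once `Gal(K̄/K_1)` does. [cite: Washington1997, §13.1] -/
theorem forall_layerSubgroup_smul_eq (hθ1 : ∀ σ : Field.absoluteGaloisGroup K, σ ∈ κ.layerSubgroup 1 → σ • θ = θ) {m : ℕ} (hm : 1 ≤ m) :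
    ∀ σ : Field.absoluteGaloisGroup K, σ ∈ κ.layerSubgroup m → σ • θ = θ :=
  fun σ hσ ↦ hθ1 σ (κ.layerSubgroup_antitone hm hσ)

omit [NumberField K] in
/-- `Gal(K̄/K_∞)` fixes `θ` once `Gal(K̄/K_1)` does. [cite: Washington1997, §13.1] -/
theorem forall_kerSubgroup_smul_eq (hθ1 : ∀ σ : Field.absoluteGaloisGroup K, σ ∈ κ.layerSubgroup 1 → σ • θ = θ) :
    ∀ σ : Field.absoluteGaloisGroup K, σ ∈ κ.kerSubgroup → σ • θ = θ :=
  fun σ hσ ↦ hθ1 σ (κ.kerSubgroup_le_layerSubgroup 1 hσ)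

include hC hd hθ in
/-- ★★★ **`#Sel_{p^∞}(W^{(d)}/K_m) = #Sel_{p^∞}(W/K_m)` for every `m ≥ 1`** (`K_1 ∋ √d`): above the first layer the twist and the curve have Selmer groups of the same order.
[cite: GreenbergLNM1716, §4 p. 107] [cite: Rubin2000, Ch. VI §1–§2] -/
theorem natCard_selmerLayer_quadraticTwist_eq (hθ1 : ∀ σ : Field.absoluteGaloisGroup K, σ ∈ κ.layerSubgroup 1 → σ • θ = θ) {m : ℕ} (hm : 1 ≤ m) :
    Nat.card ((W.quadraticTwist d).selmerLayer κ m) = Nat.card (W.selmerLayer κ m) :=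
  (natCard_selmerLayer_eq_natCard_twist W (W.quadraticTwist d) κ m
    (twistH1Equiv W hC hd hθ p (κ.layerSubgroup m) (forall_layerSubgroup_smul_eq κ hθ1 hm))
    (fun x ↦ mem_selmerGroupOver_iff_twist W hC hd hθ p (κ.layerSubgroup m) (forall_layerSubgroup_smul_eq κ hθ1 hm) x)).symm

include hC hd hθ in
/-- ★★ **`#A_m(W^{(d)}) = #A_m(W)` for every `m ≥ 1`**: Greenberg's preimages `h_m⁻¹(Sel_∞)` of the twist and of the curve have the same order above the first layer.
[cite: GreenbergLNM1716, §3 p. 85, §4 p. 107] -/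
theorem natCard_selmerInftyPreimage_quadraticTwist_eq (hθ1 : ∀ σ : Field.absoluteGaloisGroup K, σ ∈ κ.layerSubgroup 1 → σ • θ = θ) {m : ℕ} (hm : 1 ≤ m) :
    Nat.card ((W.quadraticTwist d).selmerInftyPreimage κ m) = Nat.card (W.selmerInftyPreimage κ m) :=
  (natCard_selmerInftyPreimage_eq_natCard_twist W (W.quadraticTwist d) κ m
    (twistH1Equiv W hC hd hθ p (κ.layerSubgroup m) (forall_layerSubgroup_smul_eq κ hθ1 hm))
    (twistH1Equiv W hC hd hθ p κ.kerSubgroup (forall_kerSubgroup_smul_eq κ hθ1))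
    (fun x ↦ mem_selmerGroupOver_iff_twist W hC hd hθ p κ.kerSubgroup (forall_kerSubgroup_smul_eq κ hθ1) x)
    (fun x ↦ twistH1Equiv_resOfLe W hC hd hθ p (κ.kerSubgroup_le_layerSubgroup m) (forall_kerSubgroup_smul_eq κ hθ1)
      (forall_layerSubgroup_smul_eq κ hθ1 hm) x)).symm

include hC hd hθ in
/-- ★★★ **`#ker g_m(W^{(d)}) = #ker g_m(W)` for every `m ≥ 1`** (`K_1 ∋ √d`; any `p`, any `ℤ_p`-extension; `Nat.card`, no finiteness): Greenberg's control kernels of the quadratic twist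
and of the curve COINCIDE from the first layer on — the twist enters the tower's control data only through level `0`. [cite: GreenbergLNM1716, §3 pp. 85–90, §4 p. 107] -/
theorem natCard_kerG_quadraticTwist_eq (hθ1 : ∀ σ : Field.absoluteGaloisGroup K, σ ∈ κ.layerSubgroup 1 → σ • θ = θ) {m : ℕ} (hm : 1 ≤ m) :
    Nat.card ((W.quadraticTwist d).KerG κ m) = Nat.card (W.KerG κ m) :=
  (natCard_kerG_eq_natCard_twist_kerG W (W.quadraticTwist d) κ m
    (twistH1Equiv W hC hd hθ p (κ.layerSubgroup m) (forall_layerSubgroup_smul_eq κ hθ1 hm))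
    (twistH1Equiv W hC hd hθ p κ.kerSubgroup (forall_kerSubgroup_smul_eq κ hθ1))
    (fun x ↦ mem_selmerGroupOver_iff_twist W hC hd hθ p (κ.layerSubgroup m) (forall_layerSubgroup_smul_eq κ hθ1 hm) x)
    (fun x ↦ mem_selmerGroupOver_iff_twist W hC hd hθ p κ.kerSubgroup (forall_kerSubgroup_smul_eq κ hθ1) x)
    (fun x ↦ twistH1Equiv_resOfLe W hC hd hθ p (κ.kerSubgroup_le_layerSubgroup m) (forall_kerSubgroup_smul_eq κ hθ1)
      (forall_layerSubgroup_smul_eq κ hθ1 hm) x)).symm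

end Quadratic

section QuadraticNoModel

variable {K : Type u} [Field K] [NumberField K] (W : WeierstrassCurve K) {d : K} {θ : AlgebraicClosure K} {p : ℕ} [hp : Fact p.Prime] (κ : ZpExtension K p)

/-- ★★★ Model-free form (the change of variables `C • W = W^{(1)}` exists over every number field, tree `exists_variableChange_quadraticTwist_one`): for `θ² = d ≠ 0` with `Gal(K̄/K_1)` fixing `θ`
and every `m ≥ 1`, **`#Sel_{p^∞}(W^{(d)}/K_m) = #Sel_{p^∞}(W/K_m)` and `#ker g_m(W^{(d)}) = #ker g_m(W)`**. [cite: GreenbergLNM1716, §3 pp. 85–90, §4 p. 107] -/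
theorem natCard_selmerLayer_and_kerG_quadraticTwist_eq (hd : d ≠ 0) (hθ : θ ^ 2 = algebraMap K (AlgebraicClosure K) d)
    (hθ1 : ∀ σ : Field.absoluteGaloisGroup K, σ ∈ κ.layerSubgroup 1 → σ • θ = θ) {m : ℕ} (hm : 1 ≤ m) :
    Nat.card ((W.quadraticTwist d).selmerLayer κ m) = Nat.card (W.selmerLayer κ m) ∧
      Nat.card ((W.quadraticTwist d).KerG κ m) = Nat.card (W.KerG κ m) := by
  obtain ⟨C, hC⟩ := W.exists_variableChange_quadraticTwist_one
  exact ⟨natCard_selmerLayer_quadraticTwist_eq W hC hd hθ κ hθ1 hm, natCard_kerG_quadraticTwist_eq W hC hd hθ κ hθ1 hm⟩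

end QuadraticNoModel

/-! ## §3 `K = ℚ`, `κ` cyclotomic (`ℚ_1 = ℚ(√2)`): the twist `E^{(2)}` -/

section Rat

variable (W : WeierstrassCurve ℚ) (κ : ZpExtension ℚ 2) {γ : Field.absoluteGaloisGroup ℚ}

/-- ★★★ `K = ℚ`, `κ` the cyclotomic `ℤ₂`-extension (any topological generator `γ`), ANY Weierstrass curve `E/ℚ`: **`#Sel_{2^∞}(E^{(2)}/ℚ_m) = #Sel_{2^∞}(E/ℚ_m)` and
`#ker g_m(E^{(2)}) = #ker g_m(E)` for every `m ≥ 1`** (`ℚ_m = ℚ(ζ_{2^{m+2}})⁺ ∋ √2`). For this gen's `μ`-bound `2^{μ₂} ∣ #Sel_{2^∞}(E^{(2)}/ℚ)·#ker g_0(E^{(2)})·#ker g_1(E)` the last factor is also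
`#ker g_1(E^{(2)})`; the twist's only datum not shared with `E` along the tower is at level `0`. [cite: GreenbergLNM1716, §3 pp. 85–90, §4 p. 107] [cite: Washington1997, §13.1] -/
theorem natCard_selmerLayer_and_kerG_quadraticTwist_two_eq (hκ : κ.IsCyclotomic) (hγ : κ.IsTopGenerator γ) {m : ℕ} (hm : 1 ≤ m) :
    Nat.card ((W.quadraticTwist 2).selmerLayer κ m) = Nat.card (W.selmerLayer κ m) ∧
      Nat.card ((W.quadraticTwist 2).KerG κ m) = Nat.card (W.KerG κ m) := by
  obtain ⟨θ, hθ, hθ1, -⟩ := AlignedTransportAtTwoHalfDescentLayerIndexGrowthFiniteTwistQuadratic.exists_sqrt_two_datum κ hκ hγ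
  exact natCard_selmerLayer_and_kerG_quadraticTwist_eq W κ two_ne_zero hθ hθ1 hm

end Rat

end Summit.BirchSwinnertonDyer.BirchSwinnertonDyer.Theorems.AlignedTransportAtTwoHalfDescentLayerIndexGrowthFiniteTwistKernel

end
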